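import Summits.BirchSwinnertonDyer.BirchSwinnertonDyer.Theorems.PrintCFramBottomClassIndexLawFiveLeThetaCycleLegendreAtP
import Summits.BirchSwinnertonDyer.BirchSwinnertonDyer.Theorems.PrintCFramBottomClassIndexLawFiveLeCutFormPeriodicCut
import Summits.BirchSwinnertonDyer.BirchSwinnertonDyer.Theorems.PrintCFramBottomClassIndexLawFiveLeCutFormThetaFrobenius
import Summits.BirchSwinnertonDyer.BirchSwinnertonDyer.Theorems.PrintCFramBottomClassIndexLawFiveLeCutFormCohenProduct
import Summits.BirchSwinnertonDyer.BirchSwinnertonDyer.Theorems.PrintCFramBottomClassIndexLawFiveLeCohenCutIntegrality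
import Literature.NumberTheory.ModularForms.ModPModularFormsThetaMemProof
import HarnessLib

/-!
# Crux `PrintCFram.BottomClassIndexLawFiveLe` (stmt-BirchSwinnertonDyer-20372), line `eisenstein-resource-bdp-line` —
# (G4) THE ASSEMBLY OF `stub_cutForm` (registry v23/v24) FROM ITS SOCKETS, AND FROM THE FACTS (LEAD g13, prover-bsd-line-cfram-p1-g13-0)

(CutForm⁶) — the `hcut` binder of `ThetaCycle.atP_six_of_cutForm` (w8 g6, p686877), registered as `stub_cutForm` — assembled from the
sockets posted by width on HOME/STATUS 2026-08-29T03:2x–04:1xZ: (S1) Cohen × Θ₀^p is a form on `Γ₁(4Q²)` with its rational q-expansion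
(w8 g7 `HalfIntegralBridge.exists_modularForm_qExpansion_eq_cohen_mul_theta`, p693022, from the named fact NF-A
`Cohen1975.thm31_cohenSeries_mem_halfIntModularForms`); (S2) p-integrality of the Cohen numbers on the m-cut and (S3) the dictionary on
the cut (w4 g12 `CohenCut.exists_padicInt_eq_cohenH_of_cut` / `exists_dictionary_cut`, p694662); the Katz family `ModP.modPForms` with
`ModP.katzHypotheses` (w6 g6, p689709/p690192; Fact B proved: `ModP.ThetaMem_holds`, p693862); the periodic cut (w3 g12
`CutForm.exists_modularForm_gamma1_qExpansion_cut`, `PowerSeries.coeff_mul_of_periodic_support`, p689460/p690820); the Frobenius side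
(w8 g7 `ThetaFrobenius.T_side`, p690652). CONSTRUCTION: `𝔽 := ZMod p`, `ι := PadicInt.toZMod`, `M := ModP.modPForms p N'`,
`w := ModP.filtration p N'`, `Θ := ModP.theta`, `N' = 4Q²·Q²`, `Q = 8m²r^{e+1}`, `T := (Θ₀ mod p)^p`, `G := −(reduced cut Cohen series)`;
`G·T = −(reduction of the cut of f)`, `f = H_k·Θ₀^p ∈ M_{k+(p+1)/2}(Γ₁(4Q²))` cut at period `Q` (the cut commutes with `Θ₀^p`, which is
supported on `Q²·□ ⊂ Qℕ`). RESULT (§3 `cutForm_six_of_facts`): `stub_cutForm` ⟸ NF-A ∧ (∀ p N, `ModP.WeightCongruence p N` ∧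
`ModP.ThetaFiltration p N`) — three cited refereed theorems (Cohen 1975 Thm 3.1; Katz 1973 Cor 4.4.2; Katz 1977 Thm (2)), typed
statement-only in `Literature/NumberTheory/ModularForms/`; nothing of them is discharged here. beyond-print theorem: NO (assembly).
BSD is not proved by any of this; no summit statement is proved; the crux C2 is OPEN and NOT claimed false.
-/

set_option autoImplicit false
-- summit-side namespace `Summit.BirchSwinnertonDyer.BirchSwinnertonDyer.…` (single-conjunct summit, D-0017 layout)
set_option linter.dupNamespace false

noncomputable section

open scoped Classical
open PowerSeries CongruenceSubgroup DirichletCharacter NumberField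
open Literature.NumberTheory.ModularForms Literature.NumberTheory.ModularForms.CohenEisenstein
open Literature.NumberTheory.LFunctions Literature.NumberTheory.EllipticCurves
  Literature.NumberTheory.EllipticCurves.KrizLi2019 Literature.NumberTheory.QuadraticFields

namespace Summit.BirchSwinnertonDyer.BirchSwinnertonDyer.Theorems.PrintCFram.CutFormAssembly

open Summit.BirchSwinnertonDyer.BirchSwinnertonDyer.Theorems.PrintCFram

/-! ## §1 One class datum, one auxiliary `(r, e)`: the tuple of (CutForm⁶) from the sockets -/

/-- **(G4), pointwise.** For ONE class datum and one auxiliary `(r, e)` (`r` prime `≠ p`): from (S1) at `Q = 8m²r^{e+1}`, (S2) `hInt`,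
(S3) `hDict` and the three Katz facts at level `N' = 4Q²·Q²`, the (CutForm⁶) tuple exists (`𝔽 = ZMod p`, `ι = PadicInt.toZMod`,
`(M, w, Θ) = (ModP.modPForms p N', ModP.filtration p N', ModP.theta)`, `T = (Θ₀ mod p)^p`, `G = −(reduced cut Cohen series)`).
[cite: Cohen1975, Thm. 3.1] [cite: Katz1977, Thm. (1)–(2)] [cite: Jochnowitz1982, §1] -/
theorem cutForm_tuple_of_sockets (p : ℕ) [Fact p.Prime] (m : ℕ) [NeZero m] (χ : DirichletCharacter ℚ_[p] m) (k : ℕ)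
    (h7 : 7 ≤ p) (hmp : m.Coprime p) (r e : ℕ) (hr : r.Prime) (hrp : r ≠ p)
    (hS1 : ∃ (f : ModularForm (Gamma1 (4 * (8 * m ^ 2 * r ^ (e + 1)) ^ 2)) ((k + (p + 1) / 2 : ℕ) : ℤ))
        (Θ : PowerSeries ℕ),
        (∀ n, coeff n (UpperHalfPlane.qExpansion 1 ⇑f) =
          ((coeff n (PowerSeries.mk (cohenH k) * PowerSeries.map (Nat.castRingHom ℚ) (Θ ^ p)) : ℚ) : ℂ)) ∧
        coeff 0 Θ = 1 ∧ (∀ n, coeff n Θ ≠ 0 → ∃ b, n = (8 * m ^ 2 * r ^ (e + 1)) ^ 2 * b ^ 2))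
    (hInt : ∀ a : ℕ, m ∣ a → a / m % 4 = 3 →
        (∀ q : ℕ, q.Prime → q ∣ m → q ≠ 2 → jacobiSym (-((a / m : ℕ) : ℤ)) q = 1) →
        ∃ y : ℤ_[p], (y : ℚ_[p]) = ((cohenH k a : ℚ) : ℚ_[p]))
    (hDict : ∀ (n₀ f : ℕ) (K : Type) [Field K] [NumberField K] (εK : DirichletCharacter ℚ_[p] (NumberField.discr K).natAbs),
        Squarefree n₀ → n₀ % 4 = 3 → 0 < f →
        (∀ q : ℕ, q.Prime → q ∣ m → q ≠ 2 → jacobiSym (-((m * (n₀ * f ^ 2) / m : ℕ) : ℤ)) q = 1) →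
        IsImaginaryQuadratic K → NumberField.discr K = -(n₀ : ℤ) → IsKroneckerCharacterOf K εK →
        ∃ (t : ℤ) (x : ℤ_[p]), (f = 1 → t = 1) ∧
          (x : ℚ_[p]) = (k : ℚ_[p])⁻¹ * @generalizedBernoulli ℚ_[p] _ _
            (changeLevel (dvd_mul_right m (NumberField.discr K).natAbs) χ *
              changeLevel (dvd_mul_left (NumberField.discr K).natAbs m) εK).conductor ⟨conductor_ne_zero _⟩ k
            (changeLevel (dvd_mul_right m (NumberField.discr K).natAbs) χ *
              changeLevel (dvd_mul_left (NumberField.discr K).natAbs m) εK).primitiveCharacter ∧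
          ((cohenH k (m * (n₀ * f ^ 2)) : ℚ) : ℚ_[p]) = -((t : ℚ_[p]) * (x : ℚ_[p])))
    (hKatz : ModP.WeightCongruence p (4 * (8 * m ^ 2 * r ^ (e + 1)) ^ 2 * (8 * m ^ 2 * r ^ (e + 1)) ^ 2) ∧
        ModP.ThetaMem p (4 * (8 * m ^ 2 * r ^ (e + 1)) ^ 2 * (8 * m ^ 2 * r ^ (e + 1)) ^ 2) ∧
        ModP.ThetaFiltration p (4 * (8 * m ^ 2 * r ^ (e + 1)) ^ 2 * (8 * m ^ 2 * r ^ (e + 1)) ^ 2)) :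
    ∃ (𝔽 : Type) (_ : Field 𝔽) (_ : CharP 𝔽 p) (ι : ℤ_[p] →+* 𝔽)
      (M : ℕ → Submodule 𝔽 (PowerSeries 𝔽)) (w : PowerSeries 𝔽 → ℕ) (Θ : PowerSeries 𝔽 →ₗ[𝔽] PowerSeries 𝔽)
      (G T : PowerSeries 𝔽),
      (∀ (g : PowerSeries 𝔽) (n : ℕ), coeff n (Θ g) = (n : 𝔽) * coeff n g) ∧
      (∀ (g : PowerSeries 𝔽) (j : ℕ), g ∈ M j → g ≠ 0 → w g ≤ j ∧ (p - 1) ∣ (j - w g)) ∧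
      (∀ (g : PowerSeries 𝔽) (j : ℕ), g ∈ M j → g ≠ 0 → g ∈ M (w g)) ∧
      (∀ g ∈ M 0, g = C (constantCoeff g)) ∧
      (∀ (g : PowerSeries 𝔽) (j : ℕ), g ∈ M j → Θ g ∈ M (j + p + 1)) ∧
      (∀ (g : PowerSeries 𝔽) (j : ℕ), g ∈ M j → g ≠ 0 → ¬ p ∣ w g → Θ g ≠ 0 ∧ w (Θ g) = w g + p + 1) ∧
      G * T ∈ M (k + (p + 1) / 2) ∧ T ≠ 0 ∧ (∀ j : ℕ, coeff j T ≠ 0 → p ∣ j) ∧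
      (∀ a : ℕ, coeff a G ≠ 0 →
        m ∣ a ∧ a / m % 4 = 3 ∧ (∀ q : ℕ, q.Prime → q ∣ m → q ≠ 2 → jacobiSym (-((a / m : ℕ) : ℤ)) q = 1) ∧
          (2 ∣ m → a / m % 8 = 7) ∧ r ^ e ∣ a / m ∧ ¬ r ^ (e + 1) ∣ a / m) ∧
      (∀ (n₀ f : ℕ) (K : Type) [Field K] [NumberField K] (εK : DirichletCharacter ℚ_[p] (NumberField.discr K).natAbs),
        Squarefree n₀ → n₀ % 4 = 3 → 0 < f →
        (m ∣ m * (n₀ * f ^ 2) ∧ m * (n₀ * f ^ 2) / m % 4 = 3 ∧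
          (∀ q : ℕ, q.Prime → q ∣ m → q ≠ 2 → jacobiSym (-((m * (n₀ * f ^ 2) / m : ℕ) : ℤ)) q = 1) ∧
          (2 ∣ m → m * (n₀ * f ^ 2) / m % 8 = 7) ∧ r ^ e ∣ m * (n₀ * f ^ 2) / m ∧
          ¬ r ^ (e + 1) ∣ m * (n₀ * f ^ 2) / m) →
        IsImaginaryQuadratic K → NumberField.discr K = -(n₀ : ℤ) → IsKroneckerCharacterOf K εK →
        ∃ (t : ℤ) (x : ℤ_[p]), (f = 1 → t = 1) ∧
          (x : ℚ_[p]) = (k : ℚ_[p])⁻¹ * @generalizedBernoulli ℚ_[p] _ _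
            (changeLevel (dvd_mul_right m (NumberField.discr K).natAbs) χ *
              changeLevel (dvd_mul_left (NumberField.discr K).natAbs m) εK).conductor ⟨conductor_ne_zero _⟩ k
            (changeLevel (dvd_mul_right m (NumberField.discr K).natAbs) χ *
              changeLevel (dvd_mul_left (NumberField.discr K).natAbs m) εK).primitiveCharacter ∧
          coeff (m * (n₀ * f ^ 2)) G = (t : 𝔽) * ι x) := by
  set Q : ℕ := 8 * m ^ 2 * r ^ (e + 1) with hQdef
  set N' : ℕ := 4 * Q ^ 2 * Q ^ 2 with hN'def
  have hm : 0 < m := Nat.pos_of_ne_zero (NeZero.ne m)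
  have hr0 : 0 < r := hr.pos
  have hQ : 0 < Q := by positivity
  haveI : NeZero (4 * Q ^ 2) := ⟨by positivity⟩
  haveI : NeZero N' := ⟨by positivity⟩
  have hpge : 5 ≤ p := le_trans (by norm_num) h7
  -- `p ∤ N'`
  have hpN' : ¬ p ∣ N' := by
    have hpp : p.Prime := Fact.out
    have hp2 : ¬ p ∣ 2 := by
      intro h; have := Nat.le_of_dvd (by norm_num) h; omega
    have hpm : ¬ p ∣ m := by
      intro h
      have := Nat.Coprime.eq_one_of_dvd (Nat.Coprime.symm hmp) h
      omega
    have hpr : ¬ p ∣ r := by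
      intro h
      exact hrp ((Nat.prime_dvd_prime_iff_eq hpp hr).1 h).symm
    have hpQ : ¬ p ∣ Q := by
      intro h
      rw [hQdef] at h
      rcases (Nat.Prime.dvd_mul hpp).1 h with h1 | h1
      · rcases (Nat.Prime.dvd_mul hpp).1 h1 with h2 | h2
        · exact hp2 (by
            have : p ∣ 2 ^ 3 := by simpa using h2
            exact hpp.dvd_of_dvd_pow this)
        · exact hpm (hpp.dvd_of_dvd_pow h2)
      · exact hpr (hpp.dvd_of_dvd_pow h1)
    intro h
    rw [hN'def] at h
    rcases (Nat.Prime.dvd_mul hpp).1 h with h1 | h1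
    · rcases (Nat.Prime.dvd_mul hpp).1 h1 with h2 | h2
      · exact hp2 (by
          have : p ∣ 2 ^ 2 := by simpa using h2
          exact hpp.dvd_of_dvd_pow this)
      · exact hpQ (hpp.dvd_of_dvd_pow h2)
    · exact hpQ (hpp.dvd_of_dvd_pow h1)
  -- the cut predicate and its `Q`-periodicity (w3 g12)
  let P : ℕ → Prop := fun a => m ∣ a ∧ a / m % 4 = 3 ∧
    (∀ q : ℕ, q.Prime → q ∣ m → q ≠ 2 → jacobiSym (-((a / m : ℕ) : ℤ)) q = 1) ∧
    (2 ∣ m → a / m % 8 = 7) ∧ r ^ e ∣ a / m ∧ ¬ r ^ (e + 1) ∣ a / m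
  have hPper : Function.Periodic P Q := fun a => by
    have h := CutForm.cutIndex_add_iff m r e a 1 hm
    rw [mul_one] at h
    exact propext h
  -- (S1): the form `f = H_k · Θ₀^p` on `Γ₁(4Q²)`
  obtain ⟨f, Θ₀, hfq, hΘ0, hΘsupp⟩ := hS1
  -- supports of `Θ₀^p` (over ℚ) : multiples of `Q`
  have hΘQ : ∀ j : ℕ, coeff j Θ₀ ≠ 0 → Q ∣ j := by
    intro j hj
    obtain ⟨b, hb⟩ := hΘsupp j hj
    exact ⟨Q * b ^ 2, by rw [hb]; ring⟩
  have hΘpQ : ∀ j : ℕ, coeff j (PowerSeries.map (Nat.castRingHom ℚ) (Θ₀ ^ p)) ≠ 0 → Q ∣ j := by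
    intro j hj
    rw [PowerSeries.coeff_map] at hj
    have hj' : coeff j (Θ₀ ^ p) ≠ 0 := fun h => hj (by rw [h, map_zero])
    exact ThetaFrobenius.dvd_of_coeff_pow_ne_zero_of_forall Θ₀ hΘQ p j hj'
  -- the cut of `f` (w3 g12): a form `F'` on `Γ₁(4Q²·Q²)`
  obtain ⟨F', hon, hoff⟩ := CutForm.exists_modularForm_gamma1_qExpansion_cut f m r e hm hr0
  -- rational coefficient sequence of `F'`: the cut Cohen series times `Θ₀^p`
  let Hcut : PowerSeries ℚ := PowerSeries.mk fun a => if P a then cohenH k a else 0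
  let Tq : PowerSeries ℚ := PowerSeries.map (Nat.castRingHom ℚ) (Θ₀ ^ p)
  have hcutprod : ∀ n : ℕ, (P n → coeff n (Hcut * Tq) = coeff n (PowerSeries.mk (cohenH k) * Tq)) ∧
      (¬ P n → coeff n (Hcut * Tq) = 0) := fun n =>
    PowerSeries.coeff_mul_of_periodic_support hPper (φ := PowerSeries.mk (cohenH k)) (ψ := Hcut) (T := Tq)
      (fun n hn => by simp only [Hcut, coeff_mk, if_pos hn]) (fun n hn => by simp only [Hcut, coeff_mk, if_neg hn]) hΘpQ n
  let aseq : ℕ → ℚ := fun n => coeff n (Hcut * Tq)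
  have hF'q : ∀ n, coeff n (UpperHalfPlane.qExpansion 1 ⇑F') = (aseq n : ℂ) := by
    intro n
    by_cases hn : P n
    · rw [hon n hn, hfq n]
      simp only [aseq, (hcutprod n).1 hn, Tq]
    · rw [hoff n hn]
      simp only [aseq, (hcutprod n).2 hn, Rat.cast_zero]
  -- (S2): p-adic incarnations of the Cohen numbers on the cut
  let xP : ℕ → ℤ_[p] := fun a => if h : P a then Classical.choose (hInt a h.1 h.2.1 h.2.2.1) else 0
  have hxP : ∀ a, P a → ((xP a : ℤ_[p]) : ℚ_[p]) = ((cohenH k a : ℚ) : ℚ_[p]) := by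
    intro a ha
    simp only [xP, dif_pos ha]
    exact Classical.choose_spec (hInt a ha.1 ha.2.1 ha.2.2.1)
  let y : ℕ → ℤ_[p] := fun n =>
    ∑ ij ∈ Finset.HasAntidiagonal.antidiagonal n, (if P ij.1 then xP ij.1 else 0) * ((coeff ij.2 (Θ₀ ^ p) : ℕ) : ℤ_[p])
  have hy : ∀ n, ((y n : ℤ_[p]) : ℚ_[p]) = (aseq n : ℚ_[p]) := by
    intro n
    simp only [y, aseq, PowerSeries.coeff_mul, PadicInt.coe_sum, PadicInt.coe_mul, Rat.cast_sum, Rat.cast_mul]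
    refine Finset.sum_congr rfl fun ij _ => ?_
    by_cases hi : P ij.1
    · simp only [if_pos hi, hxP ij.1 hi, Hcut, Tq, coeff_mk, PowerSeries.coeff_map, Nat.coe_castRingHom,
        Rat.cast_natCast, PadicInt.coe_natCast]
    · simp only [if_neg hi, Hcut, Tq, coeff_mk, PadicInt.coe_zero, zero_mul, Rat.cast_zero]
  -- the reduction `gbar` of the cut form is a form mod `p` of weight `k + (p+1)/2` and level `N'`
  let gbar : PowerSeries (ZMod p) := PowerSeries.mk fun n => PadicInt.toZMod (y n)
  have hgbar : gbar ∈ ModP.modPForms p N' (k + (p + 1) / 2) := by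
    refine ModP.mem_modPForms_of_coeff_eq F' aseq y hF'q hy fun n => ?_
    simp only [gbar, coeff_mk]
  let G : PowerSeries (ZMod p) := PowerSeries.mk fun a => if P a then -PadicInt.toZMod (xP a) else 0
  let T : PowerSeries (ZMod p) := (PowerSeries.map (Nat.castRingHom (ZMod p)) Θ₀) ^ p
  have hTcoeff : ∀ j, coeff j T = ((coeff j (Θ₀ ^ p) : ℕ) : ZMod p) := by
    intro j
    simp only [T, ← map_pow, PowerSeries.coeff_map, Nat.coe_castRingHom]
  have hGT : G * T = -gbar := by
    ext n
    rw [map_neg, PowerSeries.coeff_mul]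
    simp only [gbar, coeff_mk, y, map_sum, map_mul, map_natCast]
    rw [← Finset.sum_neg_distrib]
    refine Finset.sum_congr rfl fun ij _ => ?_
    rw [hTcoeff]
    by_cases hi : P ij.1
    · simp only [G, coeff_mk, if_pos hi, neg_mul]
    · simp only [G, coeff_mk, if_neg hi, map_zero, zero_mul, neg_zero]
  have hGTmem : G * T ∈ ModP.modPForms p N' (k + (p + 1) / 2) := by
    rw [hGT]
    exact (ModP.modPForms p N' (k + (p + 1) / 2)).neg_mem hgbar
  obtain ⟨hT0, hTp, -⟩ := ThetaFrobenius.T_side (𝔽 := ZMod p) p Θ₀ hΘ0 hΘsupp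
  obtain ⟨hA, hB, hC⟩ := hKatz
  have hK := ModP.katzHypotheses (p := p) (N := N') hA hB hC hpge hpN'
  refine ⟨ZMod p, inferInstance, inferInstance, PadicInt.toZMod, ModP.modPForms p N', ModP.filtration p N',
    ModP.theta (ZMod p), G, T, hK.1, hK.2.1, hK.2.2.1, hK.2.2.2.1, hK.2.2.2.2.1, hK.2.2.2.2.2, hGTmem, hT0, hTp,
    fun a ha => ?_, fun n₀ f K _ _ εK hsq h4 hf hcut hK' hdisc hεK => ?_⟩
  · -- support of `G`
    by_contra hna
    apply ha
    simp only [G, coeff_mk]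
    exact if_neg hna
  · -- the dictionary (S3)
    have hPa : P (m * (n₀ * f ^ 2)) := hcut
    obtain ⟨t, x, htf, hx, hcoh⟩ := hDict n₀ f K εK hsq h4 hf hcut.2.2.1 hK' hdisc hεK
    refine ⟨t, x, htf, hx, ?_⟩
    have hxa : xP (m * (n₀ * f ^ 2)) = -((t : ℤ_[p]) * x) := by
      have h1 := hxP _ hPa
      rw [hcoh] at h1
      have h2 : (((-((t : ℤ_[p]) * x) : ℤ_[p])) : ℚ_[p]) = -((t : ℚ_[p]) * (x : ℚ_[p])) := by
        push_cast; ring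
      exact Subtype.ext (h1.trans h2.symm)
    simp only [G, coeff_mk, if_pos hPa, hxa, map_neg, map_mul, map_intCast, neg_neg]

/-! ## §2 The registered statement (CutForm⁶) from the sockets, all class data at once -/

/-- **(G4) — `stub_cutForm`'s registered text from the four sockets as hypotheses** (`hS1` w8 g7's shape, `hInt`/`hDict` w4 g12's
shapes with the class-datum binders, `hKatz` the three Katz facts at every level); pointwise `cutForm_tuple_of_sockets`.
[cite: Cohen1975, Thm. 3.1] [cite: Katz1977, Thm. (1)–(2)] [cite: Katz1973, §4.4] [cite: Jochnowitz1982, §1] -/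
theorem cutForm_six_of_sockets
    (hS1 : ∀ (Q : ℕ), 0 < Q → ∀ (k : ℕ), 2 ≤ k → ∀ (p : ℕ), Odd p →
      ∃ (f : ModularForm (Gamma1 (4 * Q ^ 2)) ((k + (p + 1) / 2 : ℕ) : ℤ)) (Θ : PowerSeries ℕ),
        (∀ n, coeff n (UpperHalfPlane.qExpansion 1 ⇑f) =
          ((coeff n (PowerSeries.mk (cohenH k) * PowerSeries.map (Nat.castRingHom ℚ) (Θ ^ p)) : ℚ) : ℂ)) ∧
        coeff 0 Θ = 1 ∧ (∀ n, coeff n Θ ≠ 0 → ∃ b, n = Q ^ 2 * b ^ 2))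
    (hInt : ∀ (p : ℕ) [Fact p.Prime] (m : ℕ) [NeZero m] (χ : DirichletCharacter ℚ_[p] m) (k a : ℕ),
      p % 4 = 3 → 7 ≤ p → m.Coprime p → χ.IsPrimitive → χ.IsQuadratic → (k = (p + 1) / 4 ∨ k = (3 * p - 1) / 4) →
      χ (-1) * (-1) ^ k = -1 → m ∣ a → a / m % 4 = 3 →
      (∀ q : ℕ, q.Prime → q ∣ m → q ≠ 2 → jacobiSym (-((a / m : ℕ) : ℤ)) q = 1) →
      ∃ y : ℤ_[p], (y : ℚ_[p]) = ((cohenH k a : ℚ) : ℚ_[p]))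
    (hDict : ∀ (p : ℕ) [Fact p.Prime] (m : ℕ) [NeZero m] (χ : DirichletCharacter ℚ_[p] m) (k : ℕ),
      p % 4 = 3 → 7 ≤ p → m.Coprime p → χ.IsPrimitive → χ.IsQuadratic → (k = (p + 1) / 4 ∨ k = (3 * p - 1) / 4) →
      χ (-1) * (-1) ^ k = -1 →
      ∀ (n₀ f : ℕ) (K : Type) [Field K] [NumberField K] (εK : DirichletCharacter ℚ_[p] (NumberField.discr K).natAbs),
        Squarefree n₀ → n₀ % 4 = 3 → 0 < f →
        (∀ q : ℕ, q.Prime → q ∣ m → q ≠ 2 → jacobiSym (-((m * (n₀ * f ^ 2) / m : ℕ) : ℤ)) q = 1) →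
        IsImaginaryQuadratic K → NumberField.discr K = -(n₀ : ℤ) → IsKroneckerCharacterOf K εK →
        ∃ (t : ℤ) (x : ℤ_[p]), (f = 1 → t = 1) ∧
          (x : ℚ_[p]) = (k : ℚ_[p])⁻¹ * @generalizedBernoulli ℚ_[p] _ _
            (changeLevel (dvd_mul_right m (NumberField.discr K).natAbs) χ *
              changeLevel (dvd_mul_left (NumberField.discr K).natAbs m) εK).conductor ⟨conductor_ne_zero _⟩ k
            (changeLevel (dvd_mul_right m (NumberField.discr K).natAbs) χ *
              changeLevel (dvd_mul_left (NumberField.discr K).natAbs m) εK).primitiveCharacter ∧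
          ((cohenH k (m * (n₀ * f ^ 2)) : ℚ) : ℚ_[p]) = -((t : ℚ_[p]) * (x : ℚ_[p])))
    (hKatz : ∀ (p : ℕ) [Fact p.Prime] (N : ℕ), ModP.WeightCongruence p N ∧ ModP.ThetaMem p N ∧ ModP.ThetaFiltration p N) :
    ∀ (p : ℕ) [Fact p.Prime] (m : ℕ) [NeZero m] (χ : DirichletCharacter ℚ_[p] m) (k : ℕ),
      (p = 7 ∨ p = 11 ∨ p = 19 ∨ p = 43 ∨ p = 67 ∨ p = 163) →
      m.Coprime p → χ.IsPrimitive → χ.IsQuadratic → (k = (p + 1) / 4 ∨ k = (3 * p - 1) / 4) →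
      2 ≤ k → k ≤ p - 2 → χ (-1) * (-1) ^ k = -1 →
      ∀ (r e : ℕ), r.Prime → r ≠ 2 → r ≠ p → e ≤ 1 →
      ∃ (𝔽 : Type) (_ : Field 𝔽) (_ : CharP 𝔽 p) (ι : ℤ_[p] →+* 𝔽)
        (M : ℕ → Submodule 𝔽 (PowerSeries 𝔽)) (w : PowerSeries 𝔽 → ℕ) (Θ : PowerSeries 𝔽 →ₗ[𝔽] PowerSeries 𝔽)
        (G T : PowerSeries 𝔽),
        (∀ (g : PowerSeries 𝔽) (n : ℕ), coeff n (Θ g) = (n : 𝔽) * coeff n g) ∧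
        (∀ (g : PowerSeries 𝔽) (j : ℕ), g ∈ M j → g ≠ 0 → w g ≤ j ∧ (p - 1) ∣ (j - w g)) ∧
        (∀ (g : PowerSeries 𝔽) (j : ℕ), g ∈ M j → g ≠ 0 → g ∈ M (w g)) ∧
        (∀ g ∈ M 0, g = C (constantCoeff g)) ∧
        (∀ (g : PowerSeries 𝔽) (j : ℕ), g ∈ M j → Θ g ∈ M (j + p + 1)) ∧
        (∀ (g : PowerSeries 𝔽) (j : ℕ), g ∈ M j → g ≠ 0 → ¬ p ∣ w g → Θ g ≠ 0 ∧ w (Θ g) = w g + p + 1) ∧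
        G * T ∈ M (k + (p + 1) / 2) ∧ T ≠ 0 ∧ (∀ j : ℕ, coeff j T ≠ 0 → p ∣ j) ∧
        (∀ a : ℕ, coeff a G ≠ 0 →
          m ∣ a ∧ a / m % 4 = 3 ∧ (∀ q : ℕ, q.Prime → q ∣ m → q ≠ 2 → jacobiSym (-((a / m : ℕ) : ℤ)) q = 1) ∧
            (2 ∣ m → a / m % 8 = 7) ∧ r ^ e ∣ a / m ∧ ¬ r ^ (e + 1) ∣ a / m) ∧
        (∀ (n₀ f : ℕ) (K : Type) [Field K] [NumberField K] (εK : DirichletCharacter ℚ_[p] (NumberField.discr K).natAbs),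
          Squarefree n₀ → n₀ % 4 = 3 → 0 < f →
          (m ∣ m * (n₀ * f ^ 2) ∧ m * (n₀ * f ^ 2) / m % 4 = 3 ∧
            (∀ q : ℕ, q.Prime → q ∣ m → q ≠ 2 → jacobiSym (-((m * (n₀ * f ^ 2) / m : ℕ) : ℤ)) q = 1) ∧
            (2 ∣ m → m * (n₀ * f ^ 2) / m % 8 = 7) ∧ r ^ e ∣ m * (n₀ * f ^ 2) / m ∧
            ¬ r ^ (e + 1) ∣ m * (n₀ * f ^ 2) / m) →
          IsImaginaryQuadratic K → NumberField.discr K = -(n₀ : ℤ) → IsKroneckerCharacterOf K εK →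
          ∃ (t : ℤ) (x : ℤ_[p]), (f = 1 → t = 1) ∧
            (x : ℚ_[p]) = (k : ℚ_[p])⁻¹ * @generalizedBernoulli ℚ_[p] _ _
              (changeLevel (dvd_mul_right m (NumberField.discr K).natAbs) χ *
                changeLevel (dvd_mul_left (NumberField.discr K).natAbs m) εK).conductor ⟨conductor_ne_zero _⟩ k
              (changeLevel (dvd_mul_right m (NumberField.discr K).natAbs) χ *
                changeLevel (dvd_mul_left (NumberField.discr K).natAbs m) εK).primitiveCharacter ∧
            coeff (m * (n₀ * f ^ 2)) G = (t : 𝔽) * ι x) := by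
  intro p _ m _ χ k hp6 hmp hχ hχq hk hk2 _hkp hpar r e hr _hr2 hrp _he
  have hp4 : p % 4 = 3 := by rcases hp6 with h | h | h | h | h | h <;> subst h <;> norm_num
  have h7 : 7 ≤ p := by rcases hp6 with h | h | h | h | h | h <;> omega
  have hpodd : Odd p := (Fact.out : p.Prime).odd_of_ne_two (by omega)
  have hm : 0 < m := Nat.pos_of_ne_zero (NeZero.ne m)
  have hQ : 0 < 8 * m ^ 2 * r ^ (e + 1) := by have := hr.pos; positivity
  exact cutForm_tuple_of_sockets p m χ k h7 hmp r e hr hrp (hS1 _ hQ k hk2 p hpodd)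
    (fun a hma ha4 hJ => hInt p m χ k a hp4 h7 hmp hχ hχq hk hpar hma ha4 hJ)
    (fun n₀ f K _ _ εK hsq h4 hf hJ hK hdisc hεK => hDict p m χ k hp4 h7 hmp hχ hχq hk hpar n₀ f K εK hsq h4 hf hJ hK hdisc hεK)
    (hKatz p _)

/-! ## §3 `stub_cutForm` FROM THE FACTS: the sockets discharged by their landed owners -/

/-- **`stub_cutForm` (registry v23/v24, VERBATIM) ⟸ NF-A ∧ Katz's Facts A and C** — the sockets of §2 discharged BY NAME:
(S1) w8 g7 p693022 (from NF-A `Cohen1975.thm31_cohenSeries_mem_halfIntModularForms`), (S2)/(S3) w4 g12 p694662, Fact B = w6 g6's theorem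
`ModP.ThetaMem_holds` (p693862); Facts A `ModP.WeightCongruence` [Katz 1973 §4.4] and C `ModP.ThetaFiltration` [Katz 1977 Thm (2)] stay
statement-only named facts. Nothing of the three facts is discharged; BSD is not proved by any of this.
[cite: Cohen1975, Thm. 3.1] [cite: Katz1977, Thm. (2)] [cite: Katz1973, §4.4] [cite: Jochnowitz1982, §1] -/
theorem cutForm_six_of_facts (hA : Literature.NumberTheory.ModularForms.Cohen1975.thm31_cohenSeries_mem_halfIntModularForms)
    (hKatz : ∀ (p : ℕ) [Fact p.Prime] (N : ℕ), ModP.WeightCongruence p N ∧ ModP.ThetaFiltration p N) :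
    ∀ (p : ℕ) [Fact p.Prime] (m : ℕ) [NeZero m] (χ : DirichletCharacter ℚ_[p] m) (k : ℕ),
      (p = 7 ∨ p = 11 ∨ p = 19 ∨ p = 43 ∨ p = 67 ∨ p = 163) →
      m.Coprime p → χ.IsPrimitive → χ.IsQuadratic → (k = (p + 1) / 4 ∨ k = (3 * p - 1) / 4) →
      2 ≤ k → k ≤ p - 2 → χ (-1) * (-1) ^ k = -1 →
      ∀ (r e : ℕ), r.Prime → r ≠ 2 → r ≠ p → e ≤ 1 →
      ∃ (𝔽 : Type) (_ : Field 𝔽) (_ : CharP 𝔽 p) (ι : ℤ_[p] →+* 𝔽)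
        (M : ℕ → Submodule 𝔽 (PowerSeries 𝔽)) (w : PowerSeries 𝔽 → ℕ) (Θ : PowerSeries 𝔽 →ₗ[𝔽] PowerSeries 𝔽)
        (G T : PowerSeries 𝔽),
        (∀ (g : PowerSeries 𝔽) (n : ℕ), coeff n (Θ g) = (n : 𝔽) * coeff n g) ∧
        (∀ (g : PowerSeries 𝔽) (j : ℕ), g ∈ M j → g ≠ 0 → w g ≤ j ∧ (p - 1) ∣ (j - w g)) ∧
        (∀ (g : PowerSeries 𝔽) (j : ℕ), g ∈ M j → g ≠ 0 → g ∈ M (w g)) ∧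
        (∀ g ∈ M 0, g = C (constantCoeff g)) ∧
        (∀ (g : PowerSeries 𝔽) (j : ℕ), g ∈ M j → Θ g ∈ M (j + p + 1)) ∧
        (∀ (g : PowerSeries 𝔽) (j : ℕ), g ∈ M j → g ≠ 0 → ¬ p ∣ w g → Θ g ≠ 0 ∧ w (Θ g) = w g + p + 1) ∧
        G * T ∈ M (k + (p + 1) / 2) ∧ T ≠ 0 ∧ (∀ j : ℕ, coeff j T ≠ 0 → p ∣ j) ∧
        (∀ a : ℕ, coeff a G ≠ 0 →
          m ∣ a ∧ a / m % 4 = 3 ∧ (∀ q : ℕ, q.Prime → q ∣ m → q ≠ 2 → jacobiSym (-((a / m : ℕ) : ℤ)) q = 1) ∧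
            (2 ∣ m → a / m % 8 = 7) ∧ r ^ e ∣ a / m ∧ ¬ r ^ (e + 1) ∣ a / m) ∧
        (∀ (n₀ f : ℕ) (K : Type) [Field K] [NumberField K] (εK : DirichletCharacter ℚ_[p] (NumberField.discr K).natAbs),
          Squarefree n₀ → n₀ % 4 = 3 → 0 < f →
          (m ∣ m * (n₀ * f ^ 2) ∧ m * (n₀ * f ^ 2) / m % 4 = 3 ∧
            (∀ q : ℕ, q.Prime → q ∣ m → q ≠ 2 → jacobiSym (-((m * (n₀ * f ^ 2) / m : ℕ) : ℤ)) q = 1) ∧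
            (2 ∣ m → m * (n₀ * f ^ 2) / m % 8 = 7) ∧ r ^ e ∣ m * (n₀ * f ^ 2) / m ∧
            ¬ r ^ (e + 1) ∣ m * (n₀ * f ^ 2) / m) →
          IsImaginaryQuadratic K → NumberField.discr K = -(n₀ : ℤ) → IsKroneckerCharacterOf K εK →
          ∃ (t : ℤ) (x : ℤ_[p]), (f = 1 → t = 1) ∧
            (x : ℚ_[p]) = (k : ℚ_[p])⁻¹ * @generalizedBernoulli ℚ_[p] _ _
              (changeLevel (dvd_mul_right m (NumberField.discr K).natAbs) χ *
                changeLevel (dvd_mul_left (NumberField.discr K).natAbs m) εK).conductor ⟨conductor_ne_zero _⟩ k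
              (changeLevel (dvd_mul_right m (NumberField.discr K).natAbs) χ *
                changeLevel (dvd_mul_left (NumberField.discr K).natAbs m) εK).primitiveCharacter ∧
            coeff (m * (n₀ * f ^ 2)) G = (t : 𝔽) * ι x) := by
  refine cutForm_six_of_sockets
    (fun Q hQ k hk p hp => HalfIntegralBridge.exists_modularForm_qExpansion_eq_cohen_mul_theta hA hQ hk hp)
    (fun p _ m _ χ k a hp4 h7 hmp hχ hχq hk hpar hma ha4 hJ =>
      CohenCut.exists_padicInt_eq_cohenH_of_cut hp4 h7 hmp hχ hχq hk hpar hma ha4 hJ)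
    (fun p _ m _ χ k hp4 h7 hmp hχ hχq hk hpar n₀ f K _ _ εK hsq h4 hf hJ hK hdisc hεK => ?_)
    (fun p _ N => ⟨(hKatz p N).1, ModP.ThetaMem_holds p N, (hKatz p N).2⟩)
  have hm : 0 < m := Nat.pos_of_ne_zero (NeZero.ne m)
  have hJ' : ∀ q : ℕ, q.Prime → q ∣ m → q ≠ 2 → jacobiSym (-((n₀ * f ^ 2 : ℕ) : ℤ)) q = 1 := by
    intro q hq hqm hq2
    have h := hJ q hq hqm hq2
    rwa [Nat.mul_div_cancel_left _ hm] at h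
  exact CohenCut.exists_dictionary_cut hp4 h7 hmp hχ hχq hk hpar hsq h4 hf hJ' hK hdisc hεK

/-- **(AtP⁶) (= registry v22's `stub_atP`) ⟸ NF-A ∧ Katz's Facts A and C** — `atP_six_of_cutForm` ∘ `cutForm_six_of_facts`.
[cite: Cohen1975, Thm. 3.1] [cite: Katz1977, Thm. (2)] [cite: AhlgrenBoylan2003, Thm. 3] -/
theorem atP_six_of_facts (hA : Literature.NumberTheory.ModularForms.Cohen1975.thm31_cohenSeries_mem_halfIntModularForms)
    (hKatz : ∀ (p : ℕ) [Fact p.Prime] (N : ℕ), ModP.WeightCongruence p N ∧ ModP.ThetaFiltration p N) :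
    ∀ (p : ℕ) [Fact p.Prime] (m : ℕ) [NeZero m] (χ : DirichletCharacter ℚ_[p] m) (k : ℕ),
      (p = 7 ∨ p = 11 ∨ p = 19 ∨ p = 43 ∨ p = 67 ∨ p = 163) →
      m.Coprime p → χ.IsPrimitive → χ.IsQuadratic → (k = (p + 1) / 4 ∨ k = (3 * p - 1) / 4) →
      2 ≤ k → k ≤ p - 2 → χ (-1) * (-1) ^ k = -1 →
      (∃ (K₀ : Type) (_ : Field K₀) (_ : NumberField K₀) (ε₀ : DirichletCharacter ℚ_[p] (NumberField.discr K₀).natAbs),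
        IsImaginaryQuadratic K₀ ∧
        (∀ q : ℕ, q.Prime → q ∣ m → ((Ideal.span {(q : ℤ)}).primesOver (𝓞 K₀)).ncard = 2) ∧
        Odd (NumberField.discr K₀) ∧ NumberField.discr K₀ < -4 ∧ IsKroneckerCharacterOf K₀ ε₀ ∧
        ¬ ‖(k : ℚ_[p])⁻¹ * @generalizedBernoulli ℚ_[p] _ _
            (changeLevel (dvd_mul_right m (NumberField.discr K₀).natAbs) χ *
              changeLevel (dvd_mul_left (NumberField.discr K₀).natAbs m) ε₀).conductor ⟨conductor_ne_zero _⟩ k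
            (changeLevel (dvd_mul_right m (NumberField.discr K₀).natAbs) χ *
              changeLevel (dvd_mul_left (NumberField.discr K₀).natAbs m) ε₀).primitiveCharacter‖ ≤ (p : ℝ)⁻¹) →
      ∃ (K : Type) (_ : Field K) (_ : NumberField K) (εK : DirichletCharacter ℚ_[p] (NumberField.discr K).natAbs),
        IsImaginaryQuadratic K ∧
        (∀ q : ℕ, q.Prime → q ∣ p * m → ((Ideal.span {(q : ℤ)}).primesOver (𝓞 K)).ncard = 2) ∧
        Odd (NumberField.discr K) ∧ NumberField.discr K < -4 ∧ IsKroneckerCharacterOf K εK ∧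
        ¬ ‖(k : ℚ_[p])⁻¹ * @generalizedBernoulli ℚ_[p] _ _
            (changeLevel (dvd_mul_right m (NumberField.discr K).natAbs) χ *
              changeLevel (dvd_mul_left (NumberField.discr K).natAbs m) εK).conductor ⟨conductor_ne_zero _⟩ k
            (changeLevel (dvd_mul_right m (NumberField.discr K).natAbs) χ *
              changeLevel (dvd_mul_left (NumberField.discr K).natAbs m) εK).primitiveCharacter‖ ≤ (p : ℝ)⁻¹ :=
  ThetaCycle.atP_six_of_cutForm (cutForm_six_of_facts hA hKatz)

end Summit.BirchSwinnertonDyer.BirchSwinnertonDyer.Theorems.PrintCFram.CutFormAssembly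

end
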